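import Summits.RiemannHypothesis.RiemannHypothesis.Theses.LiTailMidpoint
import Summits.RiemannHypothesis.RiemannHypothesis.Theorems.LiTailMidpointLiPrimeTailResonant
import HarnessLib

/-!
# RiemannHypothesis / LiTailMidpoint — crux K1 `LiPrimeTailResonant`, the route decl (RH-FREE)

RH-FREE [rh-li-eng-4 g6].  Route `Theses/LiTailMidpoint.lean` (round 8 of the LI column, rung leaf «Li TAIL MIDPOINT LAW»
`LiTheory.LiZeroTailMidpoint`, PROOF-OF-DATA, NOT height-buying), item `LiPrimeTailResonant` (stmt-RiemannHypothesis-19865):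
the route statement VERBATIM, from `PrimeTailResonant.liPrimeTailResonant_bound` (`Theorems/LiTailMidpointLiPrimeTailResonant.lean`,
p472285), which proves it for every `m ≥ 2` without using the hypothesis `Λ(m) ≠ 0`.  Nothing here bears on the truth of RH.
-/

noncomputable section

-- D-0017: `Summit.<S>.<S>.…` is the designed namespace of a single-problem summit.
set_option linter.dupNamespace false

namespace Summit.RiemannHypothesis.RiemannHypothesis.Theorems.LiTheory

/-- **Crux K1 `LiPrimeTailResonant` of route `LiTailMidpoint`** (stmt-RiemannHypothesis-19865), verbatim the route statement:
for every prime power `m ≥ 2`, large `n` and every cut `T ∈ [c_m√n, c_m√n + 1]`,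
`|liPrimeTail n T − Σ_{2 ≤ k < m} liCoffeyTerm k n − (Λ(m)/π) m^{−1/2} liBridgeTail n (log m) T| ≤ C_m log n`. -/
theorem liPrimeTailResonant_proof :
    Summit.RiemannHypothesis.RiemannHypothesis.Theses.LiTailMidpoint.LiPrimeTailResonant := by
  intro m hm _
  exact PrimeTailResonant.liPrimeTailResonant_bound m hm

end Summit.RiemannHypothesis.RiemannHypothesis.Theorems.LiTheory

end
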